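import Summits.Parity.BatemanHorn.Theorems.AlmostPrimeZerosLinearCappedRepulsionRieszDiffEngine
import HarnessLib

/-!
# One-sided Selberg–Delange for a difference of Riesz means, wide range `R ≤ 4 log log x`
(crux stmt-Parity-17114 `Summit.Parity.BatemanHorn.Theses.AlmostPrimeZeros.DiscMajorantLog`,
line `Sketch`, stub `stub_rieszDiffEngineWideOfNegligible`, "E2b")

Everything here is PROVED (theorems only).  The registered stub is the CONDITIONAL re-run of the
tree theorem `stub_rieszDiffEngine` (crux stmt-Parity-11327): given the four negligible contour
terms for `0 ≤ R ≤ 4ℓ` (`ℓ = log log x ≥ 6`, `T = e^{3ℓ³}`; the statement of the neighbour stub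
`stub_rieszDiffNegligibleWide`, taken here as a HYPOTHESIS), the one-sided Selberg–Delange bound
for the DIFFERENCE of two Riesz means `A₁(x+h) − A₁(x)` of `Σ a(n) n^{-s} = ζ(s)^z G(s)` with data
`SelbergDelange.RieszData R (1 − 1/(4(R+1))) B z a G` (Montgomery–Vaughan §7.4, proof of
Theorem 7.17):
`‖A₁(x+h) − A₁(x)‖ ≤ h·x·(log x)^{Re z−1}·B·exp(c(1+R)log(R+2))` for `x e^{−(log log x)³} ≤ h ≤ x`,
`1 ≤ R ≤ 4 log log x`.

Compared with `stub_rieszDiffEngine` three things change: (i) the data live on the half-plane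
`σ > σ₁ = 1 − 1/(4(R+1))`, so the radius `ρ(σ₁) = min(1/(4(R+1)), zfrWidth 1/2) ≥ 1/(20ℓ)` must
still dominate `2c̄/(3ℓ³) + e^{−ℓ}` (`RieszDiffWide.eventually_master`); (ii) the range is
`1 ≤ R ≤ 4ℓ`, the negligible terms being supplied by the hypothesis; (iii) the keyhole constant is
kept at its true size `⌈R⌉!·2^{⌈R⌉} = e^{O(R log R)}` (`RieszDiffWide.keyholeConst_ceil_le`), which
gives the Γ-budget `exp(c(1+R)log(R+2))` with `c = 2(12 + M₀)`.  The fixed-parameter contour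
estimate `RieszDiff.norm_rieszMean_diff_le_of_params` is general in `σ₁` and is reused by import.

## References

* [MontgomeryVaughan2007] H. L. Montgomery, R. C. Vaughan, *Multiplicative Number Theory I*,
  CUP 2007, §7.4, proof of Theorem 7.17 (pp. 177–178).
* [Tenenbaum2015] G. Tenenbaum, *Introduction to analytic and probabilistic number theory*, 3rd
  ed., AMS GSM 163, II.5 §§5.3–5.4.
-/

noncomputable section

open Complex Set MeasureTheory Filter Topology intervalIntegral Metric
open scoped Real Nat Interval
open Literature.Analysis.Complex Literature.Analysis.Complex.Keyhole
open Literature.NumberTheory.LFunctions Literature.NumberTheory.LFunctions.SelbergDelange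
open Summit.Parity.BatemanHorn.Cruxes.LinearCappedRepulsion.JensenStieltjesMajorant
open Summit.Parity.BatemanHorn.Cruxes.LinearCappedRepulsion.JensenStieltjesMajorant.RieszDiff

namespace Summit.Parity.BatemanHorn.Cruxes.DiscMajorantLog.Sketch

namespace RieszDiffWide

/-- **The eventual conditions on `ℓ = log log x` (wide range)**: for constants `A`, `K`,
eventually `ℓ ≥ 6`, `ℓ ≥ A`, `K ℓ⁶ ≤ e^ℓ`, `(2c̄/(3ℓ³) + e^{−ℓ})·80ℓ ≤ 1` and
`2c̄/(3ℓ³) + e^{−ℓ} ≤ zfrWidth 1 / 8`. [folklore] -/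
theorem eventually_master (A K : ℝ) :
    ∀ᶠ ℓ : ℝ in atTop, 6 ≤ ℓ ∧ A ≤ ℓ ∧ K * ℓ ^ 6 ≤ Real.exp ℓ ∧
      (2 * zfrConst / (3 * ℓ ^ 3) + Real.exp (-ℓ)) * (80 * ℓ) ≤ 1 ∧
      2 * zfrConst / (3 * ℓ ^ 3) + Real.exp (-ℓ) ≤ zfrWidth 1 / 8 := by
  have h0 := RieszDiff.eventually_master A K (half_pos (zfrWidth_pos 1))
  have h1 : ∀ᶠ ℓ : ℝ in atTop, 6 ≤ ℓ := eventually_ge_atTop 6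
  have h4 : ∀ᶠ ℓ : ℝ in atTop, (2 * zfrConst / (3 * ℓ ^ 3) + Real.exp (-ℓ)) * (80 * ℓ) ≤ 1 := by
    have ht := Real.tendsto_pow_mul_exp_neg_atTop_nhds_zero 1
    have hev := (tendsto_order.1 ht).2 (1 / 200) (by norm_num)
    filter_upwards [hev, eventually_ge_atTop (1 : ℝ)] with ℓ hℓ hℓ1
    have hℓ' : ℓ ^ 1 * Real.exp (-ℓ) < 1 / 200 := hℓ
    rw [pow_one] at hℓ'
    have hc := zfrConst_pos
    have hc1 := zfrConst_le
    have hℓ3 : ℓ ≤ ℓ ^ 3 := le_self_pow₀ hℓ1 (by norm_num)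
    have hA : 2 * zfrConst / (3 * ℓ ^ 3) * (80 * ℓ) ≤ 160 * zfrConst / 3 := by
      rw [div_mul_eq_mul_div, div_le_div_iff₀ (by positivity) (by norm_num)]
      nlinarith [mul_le_mul_of_nonneg_left hℓ3 hc.le]
    calc (2 * zfrConst / (3 * ℓ ^ 3) + Real.exp (-ℓ)) * (80 * ℓ)
        = 2 * zfrConst / (3 * ℓ ^ 3) * (80 * ℓ) + 80 * (ℓ * Real.exp (-ℓ)) := by ring
      _ ≤ 160 * zfrConst / 3 + 80 * (1 / 200) := add_le_add hA (by linarith)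
      _ ≤ 1 := by linarith
  filter_upwards [h0, h1, h4] with ℓ h a c
  exact ⟨a, h.2.1, h.2.2.1, c, by linarith [h.2.2.2]⟩

/-- **The keyhole constant grows like `e^{O(R log R)}`**:
`keyholeConst ⌈R⌉ ≤ 28 exp(3 (1+R)(1 + log(1+R)))` (`⌈R⌉! ≤ ⌈R⌉^{⌈R⌉} ≤ (1+R)^{1+R} =
e^{(1+R)log(1+R)}`, `2^{⌈R⌉} ≤ e^{⌈R⌉} ≤ e^{1+R}`, `keyholeConst n ≤ 28 n! 2^n`). [folklore] -/
theorem keyholeConst_ceil_le {R : ℝ} (hR : 0 ≤ R) :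
    keyholeConst ⌈R⌉₊ ≤ 28 * Real.exp (3 * ((1 + R) * (1 + Real.log (1 + R)))) := by
  obtain ⟨n, hndef⟩ : ∃ n : ℕ, n = ⌈R⌉₊ := ⟨_, rfl⟩
  obtain ⟨P, hPdef⟩ : ∃ P : ℝ, P = (1 + R) * (1 + Real.log (1 + R)) := ⟨_, rfl⟩
  rw [← hndef, ← hPdef]
  have hn : (n : ℝ) ≤ 1 + R := by
    have := Nat.ceil_lt_add_one hR; rw [← hndef] at this; linarith
  have hR1 : 1 ≤ 1 + R := by linarith
  have hlog0 : 0 ≤ Real.log (1 + R) := Real.log_nonneg hR1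
  have hRP : 1 + R ≤ P := by
    rw [hPdef]; exact le_mul_of_one_le_right (by linarith) (by linarith)
  -- n! 2^n ≤ e^{2P} e^{P}
  have hfact : ((n ! : ℕ) : ℝ) ≤ Real.exp (2 * P) := by
    have h1 : ((n ! : ℕ) : ℝ) ≤ (n : ℝ) ^ n := by exact_mod_cast Nat.factorial_le_pow n
    have h2 : (n : ℝ) ^ n ≤ (1 + R) ^ n := pow_le_pow_left₀ (Nat.cast_nonneg n) hn n
    have h3 : (1 + R) ^ n ≤ Real.exp (2 * P) := by
      rw [← Real.rpow_natCast]
      calc (1 + R) ^ (n : ℝ) ≤ (1 + R) ^ (1 + R) := Real.rpow_le_rpow_of_exponent_le hR1 hn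
        _ = Real.exp ((1 + R) * Real.log (1 + R)) := by
            rw [Real.rpow_def_of_pos (by linarith)]; ring_nf
        _ ≤ Real.exp (2 * P) := by
            rw [Real.exp_le_exp, hPdef]
            nlinarith [mul_nonneg (by linarith : (0 : ℝ) ≤ 1 + R) hlog0]
    exact h1.trans (h2.trans h3)
  have hpow : (2 : ℝ) ^ n ≤ Real.exp P := by
    calc (2 : ℝ) ^ n ≤ Real.exp 1 ^ n :=
          pow_le_pow_left₀ (by norm_num) (by linarith [Real.add_one_le_exp (1 : ℝ)]) n
      _ = Real.exp n := by rw [← Real.exp_nat_mul, mul_one]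
      _ ≤ Real.exp P := by rw [Real.exp_le_exp]; linarith
  -- keyholeConst n ≤ 28 n! 2^n
  have hF1 : (1 : ℝ) ≤ ((n ! : ℕ) : ℝ) := by
    exact_mod_cast Nat.one_le_iff_ne_zero.2 (Nat.factorial_ne_zero n)
  have h2n : (1 : ℝ) ≤ (2 : ℝ) ^ n := one_le_pow₀ (by norm_num)
  have hE : Real.exp (1 / 2) * (2 * Real.exp (1 / 2)) = 2 * Real.exp 1 := by
    rw [show (2 : ℝ) * Real.exp 1 = 2 * (Real.exp (1 / 2) * Real.exp (1 / 2)) by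
      rw [← Real.exp_add]; norm_num]
    ring
  have hkc : keyholeConst n ≤ 28 * (((n ! : ℕ) : ℝ) * (2 : ℝ) ^ n) := by
    unfold keyholeConst
    have e : 2 * ((((n ! : ℕ) : ℝ) * 2 ^ n + 2 ^ n) * Real.exp (1 / 2) * (2 * Real.exp (1 / 2))) +
        2 * Real.exp 1 * 2 ^ n =
        Real.exp 1 * (4 * (((n ! : ℕ) : ℝ) * 2 ^ n) + 6 * 2 ^ n) := by
      have : ∀ A : ℝ, A * Real.exp (1 / 2) * (2 * Real.exp (1 / 2)) = A * (2 * Real.exp 1) := by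
        intro A; rw [mul_assoc, hE]
      rw [this]; ring
    rw [e]
    have hF2 : (2 : ℝ) ^ n ≤ ((n ! : ℕ) : ℝ) * 2 ^ n := by nlinarith
    have he : Real.exp 1 ≤ 2.7182818286 := Real.exp_one_lt_d9.le
    have h0 : (0 : ℝ) ≤ 4 * (((n ! : ℕ) : ℝ) * 2 ^ n) + 6 * 2 ^ n := by positivity
    have h1 := mul_le_mul_of_nonneg_right he h0
    linarith
  calc keyholeConst n ≤ 28 * (((n ! : ℕ) : ℝ) * (2 : ℝ) ^ n) := hkc
    _ ≤ 28 * (Real.exp (2 * P) * Real.exp P) := by gcongr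
    _ = 28 * Real.exp (3 * P) := by rw [← Real.exp_add]; ring_nf

end RieszDiffWide

set_option maxHeartbeats 400000 in
/-- **Stub E2b (one-sided Selberg–Delange for a difference of Riesz means, `R ≤ 4 log log x`,
Γ-budget), conditional on E2a.**  Given the four negligible contour terms for `0 ≤ R ≤ 4ℓ`
(`ℓ = log log x ≥ 6`, `T = e^{3ℓ³}`), there are `X₀` and `c ≥ 0` such that for all data
`SelbergDelange.RieszData R (1 − 1/(4(R+1))) B z a G` with `R ≥ 1`, all real `x ≥ X₀` with
`R ≤ 4 log log x`, and all `h` with `x·e^{−(log log x)³} ≤ h ≤ x`: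
`‖A₁(x+h) − A₁(x)‖ ≤ h · x · (log x)^{Re z − 1} · B · exp(c (1+R) log(R+2))`,
`A₁(y) = Σ_{1≤n≤y} a(n)(y − n)`.  Proof: `RieszDiff.norm_rieszMean_diff_le_of_params` with
`σ₁ = 1 − 1/(4(R+1))`, `T = exp(3ℓ³)`, `b = leftAbscissa T` (`1 − b ≤ 2c̄/(3ℓ³)`; the fit
`2c̄/(3ℓ³) + e^{−ℓ} ≤ ρ(σ₁)/4` from `(2c̄/(3ℓ³) + e^{−ℓ})·80ℓ ≤ 1`, `16(R+1) ≤ 80ℓ` and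
`2c̄/(3ℓ³) + e^{−ℓ} ≤ zfrWidth 1/8`), the four non-keyhole terms `≤ x² B e^{−ℓ³−(R+1)ℓ} ≤
h x (log x)^{Re z−1} B` by hypothesis and `RieszDiff.unit_le`, and the keyhole term
`26 e^{(π+M₀)R} keyholeConst(⌈R⌉) · h x (log x)^{Re z−1} B` with
`keyholeConst(⌈R⌉) ≤ 28 e^{3P}`, `P = (1+R)(1+log(1+R)) ≤ 2(1+R)log(R+2)`; `c = 2(12 + M₀)`.
[cite: MontgomeryVaughan2007, §7.4 pp. 177–178] -/
theorem stub_rieszDiffEngineWideOfNegligible :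
    (∀ (x L ℓ R B T C₀ M₀ Λ b : ℝ), 1 < x → L = Real.log x → ℓ = Real.log L → 6 ≤ ℓ →
      0 ≤ R → R ≤ 4 * ℓ → 0 ≤ B → T = Real.exp (3 * ℓ ^ 3) →
      (4 * ((2 * x) ^ (1 + (1 + 1 / L)) * (B / (1 / L) ^ R) / T) ≤
          x ^ 2 * B * Real.exp (-ℓ ^ 3 - (R + 1) * ℓ)) ∧
      (C₀ + 3 ≤ ℓ → 0 ≤ C₀ → 0 ≤ b → b ≤ 1 + 1 / L →
        4 * ((1 + 1 / L - b) * ((2 * x) ^ (1 + (1 + 1 / L)) *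
          (Real.exp (R * C₀) * Real.log (T + 3) ^ R) * B / T ^ 2)) ≤
          x ^ 2 * B * Real.exp (-ℓ ^ 3 - (R + 1) * ℓ)) ∧
      (0 ≤ C₀ → b ≤ 1 → (C₀ + 20) * ℓ ^ 3 ≤ L * (1 - b) →
        4 * (4 * Real.pi * ((2 * x) ^ (1 + b) * (Real.exp (R * C₀) * Real.log (T + 3) ^ R) * B)) ≤
          x ^ 2 * B * Real.exp (-ℓ ^ 3 - (R + 1) * ℓ)) ∧
      (0 ≤ M₀ → 0 ≤ Λ → 0 ≤ b → b < 1 → Real.log (1 / (1 - b)) ≤ 1 + 3 * ℓ + Λ →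
        (M₀ + Λ + 20) * ℓ ^ 3 ≤ L * (1 - b) →
        4 * (4 * ((2 * x) ^ (1 + b) * Real.exp (R * M₀) * Real.exp (Real.pi * R) * B *
          ((1 - b) ^ (-R) + 2 ^ R))) ≤
          x ^ 2 * B * Real.exp (-ℓ ^ 3 - (R + 1) * ℓ))) →
    ∃ X₀ : ℝ, ∃ c : ℝ, 0 ≤ c ∧ ∀ (R B : ℝ) (z : ℂ) (a : ℕ → ℂ) (G : ℂ → ℂ), 1 ≤ R →
      Literature.NumberTheory.LFunctions.SelbergDelange.RieszData R (1 - 1 / (4 * (R + 1))) B z a G →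
      ∀ x h : ℝ, X₀ ≤ x → R ≤ 4 * Real.log (Real.log x) →
        x * Real.exp (-(Real.log (Real.log x) ^ 3)) ≤ h → h ≤ x →
        ‖(∑ n ∈ Finset.Ioc 0 ⌊x + h⌋₊, a n * (((x + h : ℝ) : ℂ) - n)) -
            ∑ n ∈ Finset.Ioc 0 ⌊x⌋₊, a n * ((x : ℂ) - n)‖ ≤
          h * x * Real.log x ^ (z.re - 1) * B * Real.exp (c * (1 + R) * Real.log (R + 2)) := by
  intro hNeg
  -- absolute constants
  obtain ⟨C₀, hC₀0, hC₀⟩ := SatheSelberg.exists_norm_logZeta_sub_log_le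
  obtain ⟨M₀, hM₀0, hM₀⟩ := SatheSelberg.exists_norm_logZeta₁_le_near_one
  have hcbar := zfrConst_pos
  have hcbar1 := zfrConst_le
  set Λ : ℝ := Real.log (1 / zfrConst) with hΛdef
  have hΛ0 : 0 ≤ Λ := Real.log_nonneg (by rw [le_div_iff₀ hcbar]; linarith)
  set K : ℝ := 2 * (C₀ + M₀ + Λ + 20) / zfrConst with hKdef
  obtain ⟨ℓ₀, hℓ₀⟩ := Filter.eventually_atTop.1 (RieszDiffWide.eventually_master (C₀ + 3) K)
  refine ⟨Real.exp (Real.exp ℓ₀), 2 * (12 + M₀), by positivity, ?_⟩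
  intro R B z a G hR1 hData x h hxX hR4x hh1 hh2
  -- the scales
  have hX1 : 1 < Real.exp (Real.exp ℓ₀) := by
    rw [← Real.exp_zero]; exact Real.exp_lt_exp.2 (Real.exp_pos ℓ₀)
  have hx1 : 1 < x := hX1.trans_le hxX
  have hx0 : 0 < x := by linarith
  set L : ℝ := Real.log x with hLdef
  set ℓ : ℝ := Real.log L with hℓdef
  have hL0 : 0 < L := Real.log_pos hx1
  have hℓ₀ℓ : ℓ₀ ≤ ℓ := by
    have h1 : Real.exp ℓ₀ ≤ L := by rw [hLdef, Real.le_log_iff_exp_le hx0]; exact hxX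
    rw [hℓdef, Real.le_log_iff_exp_le hL0]; exact h1
  obtain ⟨hℓ6, hℓC, hKℓ, h80, hW8⟩ := hℓ₀ ℓ hℓ₀ℓ
  have hℓ2 : 2 ≤ ℓ := by linarith
  obtain ⟨-, hxL, -, hLℓ, hL7, hx2, -⟩ := scales hx1 hLdef hℓdef hℓ2
  have hℓ0 : 0 < ℓ := by linarith
  have hℓ3 : 8 ≤ ℓ ^ 3 := by
    have := pow_le_pow_left₀ (by norm_num : (0:ℝ) ≤ 2) hℓ2 3; norm_num at this; exact this
  have hR0 : 0 ≤ R := by linarith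
  have hR4 : R ≤ 4 * ℓ := hR4x
  -- the half-plane `σ > σ₁ = 1 − 1/(4(R+1))`
  set σ₁ : ℝ := 1 - 1 / (4 * (R + 1)) with hσ₁def
  have hR4pos : 0 < 4 * (R + 1) := by positivity
  have hquarter : 1 - σ₁ = 1 / (4 * (R + 1)) := by rw [hσ₁def]; ring
  have hσ₁1 : σ₁ < 1 := by
    have : 0 < 1 / (4 * (R + 1)) := by positivity
    linarith [hquarter]
  have hσ₁0 : 0 ≤ σ₁ := by
    have : 1 / (4 * (R + 1)) ≤ 1 := by rw [div_le_one hR4pos]; linarith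
    linarith [hquarter]
  -- the parameters `T`, `b = leftAbscissa T`
  set T : ℝ := Real.exp (3 * ℓ ^ 3) with hTdef
  obtain ⟨hT3, hlogT1, hlogT2⟩ := height_bounds hℓ2 hTdef
  have hT1 : 1 ≤ T := by linarith
  set b : ℝ := leftAbscissa T with hbdef
  obtain ⟨h1b, h1bpos⟩ := one_sub_leftAbscissa (by linarith : (0:ℝ) ≤ T)
  have h1bpos' : 0 < 1 - b := by rw [h1b]; exact h1bpos
  have hb1 : b < 1 := by linarith
  have hlogT0 : 0 < Real.log (T + 3) := by linarith
  -- `1 − b ≤ 2c̄/(3ℓ³) ≤ t = 2c̄/(3ℓ³) + e^{−ℓ}`, `4t ≤ 1 − σ₁ = 1/(4(R+1))`, so `b > σ₁`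
  have h1b_le : 1 - b ≤ 2 * zfrConst / (3 * ℓ ^ 3) := by
    rw [h1b]; exact div_le_div_of_nonneg_left (by linarith) (by positivity) hlogT1
  set t : ℝ := 2 * zfrConst / (3 * ℓ ^ 3) + Real.exp (-ℓ) with htdef
  have ht0 : 0 ≤ t := by rw [htdef]; positivity
  have ht16 : t * (16 * (R + 1)) ≤ 1 :=
    (mul_le_mul_of_nonneg_left (by linarith) ht0).trans h80
  have hq4 : 4 * t ≤ 1 - σ₁ := by
    rw [hquarter, le_div_iff₀ hR4pos]
    calc 4 * t * (4 * (R + 1)) = t * (16 * (R + 1)) := by ring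
      _ ≤ 1 := ht16
  have hσ₁b : σ₁ < b := by linarith [Real.exp_pos (-ℓ)]
  -- `1 − b ≥ c̄/(2ℓ³)`
  have h1b_ge : zfrConst / (2 * ℓ ^ 3) ≤ 1 - b := by
    rw [h1b]
    calc zfrConst / (2 * ℓ ^ 3) = 2 * zfrConst / (4 * ℓ ^ 3) := by field_simp; ring
      _ ≤ 2 * zfrConst / Real.log (T + 3) :=
          div_le_div_of_nonneg_left (by linarith) hlogT0 (by linarith)
  -- `β = L(1 − b) ≥ (C₀ + M₀ + Λ + 20) ℓ³`
  have hβ : (C₀ + M₀ + Λ + 20) * ℓ ^ 3 ≤ L * (1 - b) := by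
    have hL' : K * ℓ ^ 6 ≤ L := by rw [hLℓ]; exact hKℓ
    calc (C₀ + M₀ + Λ + 20) * ℓ ^ 3 = (K * ℓ ^ 6) * (zfrConst / (2 * ℓ ^ 3)) := by
          rw [hKdef]; field_simp
      _ ≤ L * (1 - b) := mul_le_mul hL' h1b_ge (by positivity) hL0.le
  have hℓ30 : 0 ≤ ℓ ^ 3 := by positivity
  have hβC : (C₀ + 20) * ℓ ^ 3 ≤ L * (1 - b) :=
    le_trans (mul_le_mul_of_nonneg_right (by linarith) hℓ30) hβ
  have hβM : (M₀ + Λ + 20) * ℓ ^ 3 ≤ L * (1 - b) :=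
    le_trans (mul_le_mul_of_nonneg_right (by linarith) hℓ30) hβ
  have hβ1 : 1 ≤ L * (1 - b) := by
    have : (1 : ℝ) ≤ (C₀ + 20) * ℓ ^ 3 := by nlinarith
    exact this.trans hβC
  -- `(β + 1)/L ≤ ρ(σ₁)/4`
  have hfit : (L * (1 - b) + 1) / L ≤ rho σ₁ / 4 := by
    have e : (L * (1 - b) + 1) / L = (1 - b) + 1 / L := by field_simp
    have h1L : 1 / L = Real.exp (-ℓ) := by rw [hLℓ, Real.exp_neg]; field_simp
    have hρ : 4 * t ≤ rho σ₁ := le_min hq4 (by linarith [hW8])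
    rw [e, h1L]; linarith [h1b_le, htdef]
  -- `log(1/(1−b)) ≤ 1 + 3ℓ + Λ`
  have hlog1b : Real.log (1 / (1 - b)) ≤ 1 + 3 * ℓ + Λ := by
    have hup : 1 / (1 - b) ≤ 2 * ℓ ^ 3 / zfrConst := by
      rw [div_le_div_iff₀ h1bpos' hcbar]
      have := (div_le_iff₀ (by positivity : (0:ℝ) < 2 * ℓ ^ 3)).1 h1b_ge
      linarith
    calc Real.log (1 / (1 - b)) ≤ Real.log (2 * ℓ ^ 3 / zfrConst) :=
          Real.log_le_log (by positivity) hup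
      _ = Real.log 2 + 3 * Real.log ℓ + Λ := by
          rw [Real.log_div (by positivity) hcbar.ne', Real.log_mul (by norm_num) (by positivity),
            Real.log_pow, hΛdef, one_div, Real.log_inv]
          push_cast; ring
      _ ≤ 1 + 3 * ℓ + Λ := by
          have := numerics.2.2
          have hℓlog : Real.log ℓ ≤ ℓ := (Real.log_le_sub_one_of_pos hℓ0).trans (by linarith)
          linarith
  -- the explicit constants far / near
  have hCf := norm_zetaPow_le_far_explicit hC₀ hR0
  have hCn := norm_exp_mul_logZeta₁_le_explicit hM₀ hR0
  -- the fixed-parameter estimate at `y = x + h`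
  have hh0 : 0 < h := lt_of_lt_of_le (by positivity) hh1
  have hxy : x ≤ x + h := by linarith
  have hy2 : x + h ≤ 2 * x := by linarith
  have hmain := norm_rieszMean_diff_le_of_params hData hσ₁1 hCf hCn hx1
    hxy hy2 (by linarith : 1 ≤ L) hT1 hσ₁b hβ1 hfit
  rw [← hLdef, ← hbdef] at hmain
  refine hmain.trans ?_
  clear hmain
  -- the four negligible terms (the hypothesis) and the unit
  have hB0 : 0 ≤ B := (norm_nonneg _).trans (hData.norm_G_le 2 (hσ₁1.trans_le (by norm_num)))
  have hb0 : 0 ≤ b := by linarith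
  have h1L0 : (0:ℝ) ≤ 1 / L := by positivity
  have hbaa : b ≤ 1 + 1 / L := by linarith
  have hN := hNeg x L ℓ R B T C₀ M₀ Λ b hx1 hLdef hℓdef hℓ6 hR0 hR4 hB0 hTdef
  clear hNeg
  have ht' := hN.1
  have hho := hN.2.1 hℓC hC₀0 hb0 hbaa
  have hfa := hN.2.2.1 hC₀0 hb1.le hβC
  have hne := hN.2.2.2 hM₀0 hΛ0 hb0 hb1 hlog1b hβM
  clear hN
  have hre : -R ≤ z.re := by
    linarith [neg_abs_le z.re, (abs_re_le_norm z).trans hData.norm_le]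
  have hU := unit_le hx1 hLdef hℓdef hℓ2 hB0 hre hh1
  obtain ⟨U, hUdef⟩ : ∃ U : ℝ, U = h * x * L ^ (z.re - 1) * B := ⟨_, rfl⟩
  have hU' : x ^ 2 * B * Real.exp (-ℓ ^ 3 - (R + 1) * ℓ) ≤ U := by rw [hUdef]; exact hU
  have hU0 : 0 ≤ U := by rw [hUdef]; exact mul_nonneg (by positivity) hB0
  -- the keyhole term: `keyholeConst ⌈R⌉ ≤ 28 e^{3P}`, `P = (1+R)(1+log(1+R)) ≥ 1 + R`
  obtain ⟨P, hPdef⟩ : ∃ P : ℝ, P = (1 + R) * (1 + Real.log (1 + R)) := ⟨_, rfl⟩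
  have hkc : keyholeConst ⌈R⌉₊ ≤ 28 * Real.exp (3 * P) := by
    rw [hPdef]; exact RieszDiffWide.keyholeConst_ceil_le hR0
  have hlogR0 : 0 ≤ Real.log (1 + R) := Real.log_nonneg (by linarith)
  have hRP : 1 + R ≤ P := by
    rw [hPdef]; exact le_mul_of_one_le_right (by linarith) (by linarith)
  have hP1 : 1 ≤ P := by linarith
  obtain ⟨E, hEdef⟩ : ∃ E : ℝ, E = Real.exp (π * R) * Real.exp (R * M₀) := ⟨_, rfl⟩
  have hE : E ≤ Real.exp ((4 + M₀) * P) := by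
    rw [hEdef, ← Real.exp_add, Real.exp_le_exp]
    have hπ4 : π ≤ 4 := Real.pi_lt_four.le
    have h1 : π * R ≤ 4 * P := mul_le_mul hπ4 (show R ≤ P by linarith) hR0 (by norm_num)
    have h2 : R * M₀ ≤ P * M₀ := mul_le_mul_of_nonneg_right (show R ≤ P by linarith) hM₀0
    linarith
  have hE0 : 0 ≤ E := by rw [hEdef]; positivity
  have hkc0 : 0 ≤ keyholeConst ⌈R⌉₊ := (keyholeConst_pos _).le
  have hkey : 13 * Real.exp (π * R) * (Real.exp (R * M₀) * B * 2) * keyholeConst ⌈R⌉₊ *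
      (x + h - x) * x * L ^ (z.re - 1) = 26 * E * keyholeConst ⌈R⌉₊ * U := by
    rw [hUdef, hEdef]; ring
  -- assembling: `(2π)⁻¹ (4U + 26 E kC U) ≤ U (1 + 5 E kC) ≤ U e^{(12+M₀)P}`
  have hπ : (2 * π)⁻¹ ≤ 1 / 6 := by
    rw [inv_eq_one_div]
    exact div_le_div_of_nonneg_left (by norm_num) (by norm_num) (by linarith [Real.pi_gt_three])
  have hS : 4 * ((2 * x) ^ (1 + (1 + 1 / L)) * (B / (1 / L) ^ R) / T) +
      4 * ((1 + 1 / L - b) * ((2 * x) ^ (1 + (1 + 1 / L)) *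
        (Real.exp (R * C₀) * Real.log (T + 3) ^ R) * B / T ^ 2)) +
      4 * (4 * π * ((2 * x) ^ (1 + b) * (Real.exp (R * C₀) * Real.log (T + 3) ^ R) * B)) +
      4 * (4 * ((2 * x) ^ (1 + b) * Real.exp (R * M₀) * Real.exp (π * R) * B *
        ((1 - b) ^ (-R) + 2 ^ R))) +
      13 * Real.exp (π * R) * (Real.exp (R * M₀) * B * 2) * keyholeConst ⌈R⌉₊ *
        (x + h - x) * x * L ^ (z.re - 1) ≤ 4 * U + 26 * E * keyholeConst ⌈R⌉₊ * U := by
    rw [hkey]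
    linarith only [ht'.trans hU', hho.trans hU', hfa.trans hU', hne.trans hU']
  have hfinal : (1 : ℝ) + 5 * E * keyholeConst ⌈R⌉₊ ≤ Real.exp ((12 + M₀) * P) :=
    final_constant_le hM₀0 hP1 hE hkc hkc0
  -- the Γ-budget: `(12 + M₀) P ≤ 2 (12 + M₀) (1 + R) log(R + 2)`
  have hlog3 : 1 ≤ Real.log (R + 2) := by
    rw [Real.le_log_iff_exp_le (by linarith)]; linarith [numerics.2.1]
  have hlog12 : Real.log (1 + R) ≤ Real.log (R + 2) := Real.log_le_log (by linarith) (by linarith)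
  have hexpP : Real.exp ((12 + M₀) * P) ≤
      Real.exp (2 * (12 + M₀) * (1 + R) * Real.log (R + 2)) := by
    rw [Real.exp_le_exp]
    have hP2 : P ≤ (1 + R) * (2 * Real.log (R + 2)) := by
      rw [hPdef]; exact mul_le_mul_of_nonneg_left (by linarith) (by linarith)
    calc (12 + M₀) * P ≤ (12 + M₀) * ((1 + R) * (2 * Real.log (R + 2))) :=
          mul_le_mul_of_nonneg_left hP2 (by linarith)
      _ = 2 * (12 + M₀) * (1 + R) * Real.log (R + 2) := by ring
  calc (2 * π)⁻¹ * (4 * ((2 * x) ^ (1 + (1 + 1 / L)) * (B / (1 / L) ^ R) / T) +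
        4 * ((1 + 1 / L - b) * ((2 * x) ^ (1 + (1 + 1 / L)) *
          (Real.exp (R * C₀) * Real.log (T + 3) ^ R) * B / T ^ 2)) +
        4 * (4 * π * ((2 * x) ^ (1 + b) * (Real.exp (R * C₀) * Real.log (T + 3) ^ R) * B)) +
        4 * (4 * ((2 * x) ^ (1 + b) * Real.exp (R * M₀) * Real.exp (π * R) * B *
          ((1 - b) ^ (-R) + 2 ^ R))) +
        13 * Real.exp (π * R) * (Real.exp (R * M₀) * B * 2) * keyholeConst ⌈R⌉₊ *
          (x + h - x) * x * L ^ (z.re - 1))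
      ≤ (2 * π)⁻¹ * (4 * U + 26 * E * keyholeConst ⌈R⌉₊ * U) :=
        mul_le_mul_of_nonneg_left hS (by positivity)
    _ ≤ (1 / 6) * (4 * U + 26 * E * keyholeConst ⌈R⌉₊ * U) :=
        mul_le_mul_of_nonneg_right hπ (by positivity)
    _ ≤ U * (1 + 5 * E * keyholeConst ⌈R⌉₊) := by
        have h0 : 0 ≤ E * keyholeConst ⌈R⌉₊ * U := by positivity
        nlinarith only [h0, hU0]
    _ ≤ U * Real.exp ((12 + M₀) * P) := mul_le_mul_of_nonneg_left hfinal hU0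
    _ ≤ U * Real.exp (2 * (12 + M₀) * (1 + R) * Real.log (R + 2)) :=
        mul_le_mul_of_nonneg_left hexpP hU0
    _ = h * x * L ^ (z.re - 1) * B * Real.exp (2 * (12 + M₀) * (1 + R) * Real.log (R + 2)) := by
        rw [hUdef]

end Summit.Parity.BatemanHorn.Cruxes.DiscMajorantLog.Sketch

end
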